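import Summits.SmoothPoincare4.SmoothPoincare4.Theorems.ConvexBisectionAcyclicBisectionExistsBeltAmbientPush
import Summits.SmoothPoincare4.SmoothPoincare4.Theorems.ConvexBisectionAcyclicBisectionExistsPageTwistingTransverseLoop
import Summits.SmoothPoincare4.SmoothPoincare4.Theorems.ConvexBisectionAcyclicBisectionExistsPageInvariance
import Literature.Topology.FourManifolds.LefschetzHandlebody
import HarnessLib

/-!
# Rotating the page push-off to the prescribed page (the last phase of node T3c-1′)
(node T3c-1′ `node_belt_isotopic_pushoff` of the sub-goal T3 of stub `stub_steinRealisation` (NF6), line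
`modp-braid-orbits`, crux `ConvexBisection.AcyclicBisectionExists`, item stmt-SmoothPoincare4-10508;
wave 4, worker Y1, lead c5; assembly part 2, registered sub-goal `helper_belt_pushoffRotation`)

After the slide (V6), the tube comparison (Z5), and the push-off inside the page tube (Y2), the `j`-th component of
the isotopy of node T3c-1′ is a framed knot `(P, ν)` in the page of direction `pageDir n j · e^{-iφ₀}`
(`φ₀ = κ μ η'` small).  This file rotates it, by the page-rotation isotopy `R` of the base (clauses of
`helper_exists_pageTube`: `R_t` reads `θ (t, ·)` in `ℝ⁴`, `w ∘ θ_t = e^{iκt} w` near the base, `θ_t` preserves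
the flat part), to the PRESCRIBED page `pageDir n j · e^{-iη}` of the node (`0 < φ₀ ≤ η`, `η n < π`):

* §1 `R_t` maps the page of direction `c` onto the page of direction `e^{iκt} c` (`mem_page_ambient`);
* §2 angular separation: pages `pageDir n i · e^{-iφ}`, `pageDir n j · e^{-iψ}` with `|φ - ψ| < 2π/n` only meet
  for `i = j`, `φ = ψ` (`pageDir_rot_ne`) — so the rotating push-off never meets an attaching circle (these lie
  in the pages `pageDir n i`, `IsLefschetzLink.mem_page`) and push-offs of distinct components never meet;
* §3 `exists_pushoffRotation`: the isotopy of knots `t ↦ R_{s(t) τ} ∘ P` (`τ = (φ₀ - η)/κ`, `s` the smooth clamp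
  `Real.smoothTransition`, so that ALL real times stay in `[0, τ]`), with its framing family `d(R_{s(t)τ}) ν`
  (`…BeltAmbientPush.lean`): every stage lies in the page of angle `-(φ₀ + s(t)(η - φ₀))`, off all cores; the end
  lies in the prescribed page; shadow and page twisting are unchanged (`shadow_comp_ambientIsotopy`,
  `pageTwisting_eq_of_bundle_family` with `pageTwistingLoop_ne_zero_of_isKnotFraming` at every stage);
* §4 the registered helper.

Everything is proved; no named facts, no `sorry`.

## References
* R. E. Gompf, A. I. Stipsicz, *4-Manifolds and Kirby Calculus* (1999), §8.2. [GompfStipsicz1999]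
* J. B. Etnyre, T. Fuller, *Realizing 4-manifolds as achiral Lefschetz fibrations*, IMRN 2006, §2. [EtnyreFuller2006]
-/

noncomputable section

-- the prescribed namespace `Summit.<P>.<Sub>.…` duplicates `SmoothPoincare4` (P = Sub)
set_option linter.dupNamespace false

open scoped Manifold ContDiff Topology
open Set Function Metric Filter Bundle

namespace Summit.SmoothPoincare4.SmoothPoincare4.Theorems.AcyclicBisectionExists.ModpBraidOrbits

open Literature.Topology.FourManifolds Literature.Topology.FourManifolds.LefschetzBase
  Literature.Topology.FourManifolds.HandleAttachingMap Literature.Geometry.Symplectic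

variable {g : ℕ}

/-! ### §1 Stages of the page rotation map pages to pages -/

section Pages

variable (R : AmbientIsotopy (𝓡∂ 4) (Base g)) {κ : ℝ} {θ : ℝ × EuclideanSpace ℝ (Fin 4) → EuclideanSpace ℝ (Fin 4)}
  (hR1 : ∀ (t : ℝ) (x : Base g), (R.toFun t x).1 = θ (t, x.1))
  (hR2 : ∀ x, rho g x ≤ 3 / 10 → ∀ t, w g (θ (t, x)) = Complex.exp (Complex.I * κ * t) * w g x)
  (hR3 : ∀ t x, ‖cx (θ (t, x))‖ ^ 2 < 4 ↔ ‖cx x‖ ^ 2 < 4)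

include hR1 hR2 hR3 in
/-- **`R_t` maps the page of direction `c` into the page of direction `e^{iκt} c`.** [folklore] -/
theorem mem_page_ambient {c : ℂ} (hc : ‖c‖ = 1) {x : Base g} (hx : x ∈ page g c) (t : ℝ) :
    R.toFun t x ∈ page g (Complex.exp (Complex.I * κ * t) * c) := by
  have hρ : rho g x.1 = 1 / 4 := rho_eq_of_mem_page g hc hx
  refine ⟨?_, ?_⟩
  · show ‖cx (R.toFun t x).1‖ ^ 2 < 4
    rw [hR1, hR3]; exact hx.1
  · show w g (R.toFun t x).1 = _
    rw [hR1, hR2 _ (by rw [hρ]; norm_num), hx.2, mul_div_assoc]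

end Pages

/-! ### §2 Angular separation of the rotated pages -/

/-- `pageDir n k · e^{-iφ} = e^{i(-2π(k+1/2)/n - φ)}`. [folklore] -/
theorem pageDir_mul_exp (n k : ℕ) (φ : ℝ) :
    pageDir n k * Complex.exp (-(φ : ℂ) * Complex.I) =
      Complex.exp (((-(2 * Real.pi * (k + 1 / 2) / n) - φ : ℝ) : ℂ) * Complex.I) := by
  rw [pageDir, ← Complex.exp_add]
  congr 1
  push_cast
  ring

/-- **Angular separation**: for letters `i, j < n` and angles with `|φ - ψ| < 2π/n`, the directions
`pageDir n i · e^{-iφ}` and `pageDir n j · e^{-iψ}` agree only if `i = j` and `φ = ψ`. [folklore] -/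
theorem pageDir_rot_ne {n i j : ℕ} (hi : i < n) (hj : j < n) {φ ψ : ℝ} (hij : i ≠ j ∨ φ ≠ ψ)
    (hd : |φ - ψ| < 2 * Real.pi / n) :
    pageDir n i * Complex.exp (-(φ : ℂ) * Complex.I) ≠ pageDir n j * Complex.exp (-(ψ : ℂ) * Complex.I) := by
  intro heq
  have hn : (0 : ℝ) < n := by exact_mod_cast (Nat.zero_le i).trans_lt hi
  rw [pageDir_mul_exp, pageDir_mul_exp, Complex.exp_eq_exp_iff_exists_int] at heq
  obtain ⟨m, hm⟩ := heq
  -- the real equation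
  have hre : (-(2 * Real.pi * (i + 1 / 2) / n) - φ : ℝ) =
      (-(2 * Real.pi * (j + 1 / 2) / n) - ψ : ℝ) + m * (2 * Real.pi) := by
    have h1 := congrArg Complex.im hm
    simpa using h1
  -- `ψ - φ = (2π/n) q` with the integer `q = i - j + m n`
  have hq : ψ - φ = 2 * Real.pi / n * ((i : ℝ) - j + m * n) := by
    have hn0 : (n : ℝ) ≠ 0 := hn.ne'
    field_simp
    field_simp at hre
    linarith
  have hpos : 0 < 2 * Real.pi / n := div_pos (by positivity) hn
  have hq1 : |((i : ℝ) - j + m * n)| < 1 := by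
    have h1 : |ψ - φ| < 2 * Real.pi / n := by rw [abs_sub_comm]; exact hd
    rw [hq, abs_mul, abs_of_pos hpos] at h1
    exact (mul_lt_iff_lt_one_right hpos).1 h1
  have hqZ : ((i : ℤ) - j + m * n) = 0 := by
    have h2 : |(((i : ℤ) - j + m * n : ℤ) : ℝ)| < 1 := by push_cast; exact hq1
    have h3 : |((i : ℤ) - j + m * n)| < 1 := by exact_mod_cast h2
    exact Int.abs_lt_one_iff.1 h3
  -- `m = 0` and `i = j`
  have hm0 : m = 0 := by
    by_contra hm0
    have h1 : (n : ℤ) ≤ |m * n| := by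
      rw [abs_mul, Nat.abs_cast]
      exact le_mul_of_one_le_left (by positivity) (Int.one_le_abs hm0)
    have h2 : |m * (n : ℤ)| = |(j : ℤ) - i| := by
      have : m * (n : ℤ) = (j : ℤ) - i := by linarith
      rw [this]
    have h3 : |(j : ℤ) - i| < n := by
      rw [abs_lt]; constructor <;> omega
    omega
  rw [hm0, zero_mul, add_zero, sub_eq_zero] at hqZ
  have hij' : i = j := by exact_mod_cast hqZ
  rcases hij with hij | hij
  · exact hij hij'
  · apply hij
    have : ψ - φ = 0 := by
      rw [hq, hij', hm0]; push_cast; ring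
    linarith

/-! ### §3 The rotation of the push-off -/

section Rotation

variable {l : List ((Fin g ⊕ Fin g → ℤ) × Bool)} {h : Fin l.length → HandleAttachingMap 3 2 (Base g)}
  (hlink : IsLefschetzLink g l h) (j : Fin l.length)
  (R : AmbientIsotopy (𝓡∂ 4) (Base g)) {κ : ℝ} (hκ : 0 < κ) {θ : ℝ × EuclideanSpace ℝ (Fin 4) → EuclideanSpace ℝ (Fin 4)}
  (hR1 : ∀ (t : ℝ) (x : Base g), (R.toFun t x).1 = θ (t, x.1))
  (hR2 : ∀ x, rho g x ≤ 3 / 10 → ∀ t, w g (θ (t, x)) = Complex.exp (Complex.I * κ * t) * w g x)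
  (hR3 : ∀ t x, ‖cx (θ (t, x))‖ ^ 2 < 4 ↔ ‖cx x‖ ^ 2 < 4)
  {η φ₀ : ℝ} (hφ₀ : 0 < φ₀) (hφη : φ₀ ≤ η) (hηn : η * l.length < Real.pi)
  {P : sphere (0 : EuclideanSpace ℝ (Fin 2)) 1 → Base g} {ν : sphere (0 : EuclideanSpace ℝ (Fin 2)) 1 → EuclideanSpace ℝ (Fin 4)}
  (hP : IsBoundaryKnot P) (hν : IsKnotFraming P ν)
  (hPpage : ∀ u, P u ∈ page g (pageDir l.length j * Complex.exp (-(φ₀ : ℂ) * Complex.I)))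

/-- The rotated direction: `e^{iκ s (φ₀-η)/κ} · pageDir n j e^{-iφ₀} = pageDir n j e^{-i(φ₀ + s(η-φ₀))}`. [folklore] -/
theorem rot_pageDir_eq (hκ : 0 < κ) (n k : ℕ) (s φ₀ η : ℝ) :
    Complex.exp (Complex.I * κ * ((s * ((φ₀ - η) / κ) : ℝ) : ℂ)) * (pageDir n k * Complex.exp (-(φ₀ : ℂ) * Complex.I)) =
      pageDir n k * Complex.exp (-((φ₀ + s * (η - φ₀) : ℝ) : ℂ) * Complex.I) := by
  rw [mul_left_comm, ← Complex.exp_add]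
  congr 1
  have hκ0 : (κ : ℂ) ≠ 0 := by exact_mod_cast hκ.ne'
  push_cast
  field_simp
  ring

/-- The page direction of the push-off has norm one. [folklore] -/
theorem norm_pageDir_mul_exp (n k : ℕ) (φ : ℝ) : ‖pageDir n k * Complex.exp (-(φ : ℂ) * Complex.I)‖ = 1 := by
  rw [pageDir_mul_exp, Complex.norm_exp_ofReal_mul_I]

include hR1 hR2 hR3 hPpage hκ in
/-- **Every stage of the rotation lies in a page**: `R_{sτ} (P u) ∈ page (pageDir n j · e^{-i(φ₀ + s(η - φ₀))})`,
`τ = (φ₀ - η)/κ`. [folklore] -/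
theorem rot_mem_page (s : ℝ) (u : sphere (0 : EuclideanSpace ℝ (Fin 2)) 1) :
    R.toFun (s * ((φ₀ - η) / κ)) (P u) ∈ page g (pageDir l.length j * Complex.exp (-((φ₀ + s * (η - φ₀) : ℝ) : ℂ) * Complex.I)) := by
  rw [← rot_pageDir_eq hκ]
  exact mem_page_ambient R hR1 hR2 hR3 (norm_pageDir_mul_exp _ _ _) (hPpage u) (s * ((φ₀ - η) / κ))

include hlink hR1 hR2 hR3 hPpage hκ hφ₀ hφη hηn in
/-- **The rotating push-off stays off all cores** (the attaching circles lie in the pages `pageDir n i`; the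
rotated page has angle in `[φ₀, η] ⊆ (0, π/n)`). [folklore] -/
theorem rot_mem_coresComplement {s : ℝ} (hs : s ∈ Icc (0 : ℝ) 1) (u : sphere (0 : EuclideanSpace ℝ (Fin 2)) 1) :
    R.toFun (s * ((φ₀ - η) / κ)) (P u) ∈ coresComplement h := by
  rw [mem_coresComplement]
  intro i hi
  rw [← range_attachingCircle] at hi
  obtain ⟨v, hv⟩ := hi
  have hn : (0 : ℝ) < l.length := by exact_mod_cast (Nat.zero_le j.1).trans_lt j.2
  have hφ : 0 < φ₀ + s * (η - φ₀) ∧ φ₀ + s * (η - φ₀) ≤ η := by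
    constructor <;> nlinarith [hs.1, hs.2]
  have hne := pageDir_rot_ne (n := l.length) i.2 j.2 (φ := 0) (ψ := φ₀ + s * (η - φ₀)) (Or.inr (by linarith))
    (by
      rw [zero_sub, abs_neg, abs_of_pos hφ.1]
      have h1 : η < Real.pi / l.length := by rw [lt_div_iff₀ hn]; exact hηn
      have h2 : Real.pi / l.length ≤ 2 * Real.pi / l.length := by
        apply div_le_div_of_nonneg_right _ hn.le; linarith [Real.pi_pos]
      linarith)
  have h1 : (h i).attachingCircle v ∈ page g (pageDir l.length i * Complex.exp (-((0 : ℝ) : ℂ) * Complex.I)) := by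
    have : pageDir l.length i * Complex.exp (-((0 : ℝ) : ℂ) * Complex.I) = pageDir l.length i := by simp
    rw [this]; exact hlink.mem_page i v
  have h2 := rot_mem_page j R hκ hR1 hR2 hR3 (η := η) hPpage s u
  rw [← hv] at h2
  exact Set.disjoint_left.1 (disjoint_page g hne) h1 h2

include hlink hR1 hR2 hR3 hPpage hκ hφ₀ hφη hηn in
/-- **The rotation of the page push-off to the prescribed page** (see the module docstring).
[cite: GompfStipsicz1999, §8.2] -/
theorem exists_pushoffRotation (hP : IsBoundaryKnot P) (hν : IsKnotFraming P ν) :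
    ∃ (Ψ : KnotIsotopyInBoundary P (fun u => R.toFun ((φ₀ - η) / κ) (P u)))
      (νt : ℝ → sphere (0 : EuclideanSpace ℝ (Fin 2)) 1 → EuclideanSpace ℝ (Fin 4)),
      (∀ t u, Ψ.toFun t u = R.toFun (Real.smoothTransition t * ((φ₀ - η) / κ)) (P u)) ∧
      (∀ t u, νt t u = mfderiv (𝓡∂ 4) (𝓡∂ 4) (R.toFun (Real.smoothTransition t * ((φ₀ - η) / κ))) (P u) (ν u)) ∧
      (∀ t u, Ψ.toFun t u ∈ coresComplement h) ∧
      (∀ t u, ∃ φ : ℝ, φ₀ ≤ φ ∧ φ ≤ η ∧ Ψ.toFun t u ∈ page g (pageDir l.length j * Complex.exp (-(φ : ℂ) * Complex.I))) ∧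
      IsFramingAlong Ψ ν νt ∧
      (∀ u, R.toFun ((φ₀ - η) / κ) (P u) ∈ page g (pageDir l.length j * Complex.exp (-(η : ℂ) * Complex.I))) ∧
      (∀ (hc : Continuous P) (hc' : Continuous fun u => R.toFun ((φ₀ - η) / κ) (P u)),
        shadow g (fun u => R.toFun ((φ₀ - η) / κ) (P u)) hc' = shadow g P hc) ∧
      pageTwisting g (fun u => R.toFun ((φ₀ - η) / κ) (P u)) (νt 1) = pageTwisting g P ν := by
  set τ : ℝ := (φ₀ - η) / κ with hτ
  have hclamp : ContMDiff 𝓘(ℝ, ℝ) 𝓘(ℝ, ℝ) ∞ (fun t : ℝ => Real.smoothTransition t * τ) :=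
    (Real.smoothTransition.contDiff.mul contDiff_const).contMDiff
  have hsI : ∀ t : ℝ, Real.smoothTransition t ∈ Icc (0 : ℝ) 1 :=
    fun t => ⟨Real.smoothTransition.nonneg t, Real.smoothTransition.le_one t⟩
  -- the isotopy of knots, with clamped time
  let Ψ : KnotIsotopyInBoundary P (fun u => R.toFun τ (P u)) :=
    { toFun := fun t u => R.toFun (Real.smoothTransition t * τ) (P u)
      contMDiff := R.contMDiff.comp ((hclamp.comp contMDiff_fst).prodMk (hP.isSmoothEmbedding.contMDiff.comp contMDiff_snd))
      isSmoothEmbedding := fun t => hP.isSmoothEmbedding.diffeomorph_comp (R.toDiffeomorph (Real.smoothTransition t * τ))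
      map_zero := by
        funext u
        show R.toFun (Real.smoothTransition 0 * τ) (P u) = P u
        rw [Real.smoothTransition.zero, zero_mul, R.map_zero]
        rfl
      map_one := by
        funext u
        show R.toFun (Real.smoothTransition 1 * τ) (P u) = R.toFun τ (P u)
        rw [Real.smoothTransition.one, one_mul]
      isBoundaryPoint := fun t _ u => isBoundaryPoint_ambient R _ (hP.isBoundaryPoint u) }
  have hΨ : ∀ t u, Ψ.toFun t u = R.toFun (Real.smoothTransition t * τ) (P u) := fun t u => rfl
  -- the framing family
  have hfr : IsFramingAlong Ψ ν fun t u => mfderiv (𝓡∂ 4) (𝓡∂ 4) (R.toFun (Real.smoothTransition t * τ)) (P u) (ν u) :=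
    { apply_zero := by
        funext u
        show mfderiv (𝓡∂ 4) (𝓡∂ 4) (R.toFun (Real.smoothTransition 0 * τ)) (P u) (ν u) = ν u
        rw [Real.smoothTransition.zero, zero_mul, R.map_zero, mfderiv_id]
        rfl
      isKnotFraming := fun t _ => isKnotFraming_ambient_push R _ hP hν
      continuousOn := by
        have h1 := continuous_mfderiv_ambientIsotopy_bundle R hν.continuous
        have h2 : Continuous fun p : ℝ × (sphere (0 : EuclideanSpace ℝ (Fin 2)) 1) =>
            ((Real.smoothTransition p.1 * τ, p.2) : ℝ × _) :=
          (hclamp.continuous.comp continuous_fst).prodMk continuous_snd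
        exact ((h1.comp h2).congr fun p => rfl).continuousOn }
  -- page twisting along the (unclamped) family `s ↦ R_{sτ}`
  have hP1 : ContMDiff (𝓡 1) (𝓡∂ 4) 1 P := hP.isSmoothEmbedding.contMDiff.of_le (by simp)
  have htw : pageTwisting g (fun u => R.toFun τ (P u)) (fun u => mfderiv (𝓡∂ 4) (𝓡∂ 4) (R.toFun τ) (P u) (ν u)) =
      pageTwisting g P ν := by
    have key := pageTwisting_eq_of_bundle_family (g := g) (K := fun s u => R.toFun (s * τ) (P u))
      (ν := fun s u => mfderiv (𝓡∂ 4) (𝓡∂ 4) (R.toFun (s * τ)) (P u) (ν u)) ?_ ?_ ?_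
    · have e0 : (fun u => mfderiv (𝓡∂ 4) (𝓡∂ 4) (R.toFun (0 * τ)) (P u) (ν u)) = ν := by
        funext u
        rw [zero_mul, R.map_zero, mfderiv_id]
        rfl
      have e0' : (fun u => R.toFun (0 * τ) (P u)) = P := by
        funext u; rw [zero_mul, R.map_zero]; rfl
      have e1 : (fun u => R.toFun (1 * τ) (P u)) = fun u => R.toFun τ (P u) := by
        funext u; rw [one_mul]
      have e1' : (fun u => mfderiv (𝓡∂ 4) (𝓡∂ 4) (R.toFun (1 * τ)) (P u) (ν u)) =
          fun u => mfderiv (𝓡∂ 4) (𝓡∂ 4) (R.toFun τ) (P u) (ν u) := by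
        funext u; rw [one_mul]
      have key' : pageTwisting g (fun u => R.toFun (0 * τ) (P u)) (fun u => mfderiv (𝓡∂ 4) (𝓡∂ 4) (R.toFun (0 * τ)) (P u) (ν u)) =
          pageTwisting g (fun u => R.toFun (1 * τ) (P u)) (fun u => mfderiv (𝓡∂ 4) (𝓡∂ 4) (R.toFun (1 * τ)) (P u) (ν u)) := key
      rw [e0, e0', e1, e1'] at key'
      exact key'.symm
    · have h1 := continuous_mfderiv_ambientIsotopy_bundle R hν.continuous
      have h2 : Continuous fun p : ℝ × (sphere (0 : EuclideanSpace ℝ (Fin 2)) 1) => ((p.1 * τ, p.2) : ℝ × _) := by fun_prop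
      exact ((h1.comp h2).congr fun p => rfl).continuousOn
    · have hF := (contDiff_ambCurve_ambientIsotopy R hP1).comp
        ((contDiff_fst.mul contDiff_const).prodMk contDiff_snd : ContDiff ℝ 1 fun p : ℝ × ℝ => ((p.1 * τ, p.2) : ℝ × ℝ))
      exact continuousOn_deriv_of_contDiff_family (K := fun s u => R.toFun (s * τ) (P u)) hF _
    · intro s _ t _
      exact pageTwistingLoop_ne_zero_of_isKnotFraming (norm_pageDir_mul_exp _ _ _)
        (hP.isSmoothEmbedding.diffeomorph_comp (R.toDiffeomorph (s * τ)))
        (rot_mem_page j R hκ hR1 hR2 hR3 (η := η) hPpage s) (isKnotFraming_ambient_push R _ hP hν) t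
  refine ⟨Ψ, _, hΨ, fun t u => rfl, fun t u => rot_mem_coresComplement hlink j R hκ hR1 hR2 hR3 hφ₀ hφη hηn hPpage (hsI t) u,
    fun t u => ⟨φ₀ + Real.smoothTransition t * (η - φ₀), ?_, ?_, rot_mem_page j R hκ hR1 hR2 hR3 (η := η) hPpage _ u⟩, hfr,
    fun u => ?_, fun hc hc' => shadow_comp_ambientIsotopy R τ hc hc', ?_⟩
  · nlinarith [(hsI t).1, (hsI t).2]
  · nlinarith [(hsI t).1, (hsI t).2]
  · have h1 := rot_mem_page j R hκ hR1 hR2 hR3 (η := η) hPpage 1 u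
    have e : ((φ₀ + 1 * (η - φ₀) : ℝ) : ℂ) = (η : ℂ) := by push_cast; ring
    rw [e, one_mul] at h1
    exact h1
  · have e : (fun u => mfderiv (𝓡∂ 4) (𝓡∂ 4) (R.toFun (Real.smoothTransition 1 * τ)) (P u) (ν u)) =
        fun u => mfderiv (𝓡∂ 4) (𝓡∂ 4) (R.toFun τ) (P u) (ν u) := by
      funext u; rw [Real.smoothTransition.one, one_mul]
    show pageTwisting g (fun u => R.toFun τ (P u)) (fun u => mfderiv (𝓡∂ 4) (𝓡∂ 4) (R.toFun (Real.smoothTransition 1 * τ)) (P u) (ν u)) = _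
    rw [e]
    exact htw

end Rotation

/-! ### §4 Registered helper -/

/-- **Registered helper `helper_belt_pushoffRotation` (node T3c-1′ of NF6 `stub_steinRealisation`, assembly part 2
= the rotation phase, wave 4, lead c5).**  See `exists_pushoffRotation` and the module docstring.
[cite: GompfStipsicz1999, §8.2] -/
theorem helper_belt_pushoffRotation : 
    ∀ (g : ℕ) (l : List ((Fin g ⊕ Fin g → ℤ) × Bool)) (h : Fin l.length → Literature.Topology.FourManifolds.HandleAttachingMap 3 2 (Literature.Topology.FourManifolds.LefschetzBase.Base g)), Literature.Topology.FourManifolds.LefschetzBase.IsLefschetzLink g l h → ∀ (j : Fin l.length) (R : Literature.Topology.FourManifolds.AmbientIsotopy (𝓡∂ 4) (Literature.Topology.FourManifolds.LefschetzBase.Base g)) (κ : ℝ) (θ : ℝ × EuclideanSpace ℝ (Fin 4) → EuclideanSpace ℝ (Fin 4)), 0 < κ → (∀ (t : ℝ) (x : Literature.Topology.FourManifolds.LefschetzBase.Base g), (R.toFun t x).1 = θ (t, x.1)) → (∀ x, Literature.Topology.FourManifolds.LefschetzBase.rho g x ≤ 3 / 10 → ∀ t, Literature.Topology.FourManifolds.LefschetzBase.w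 g (θ (t, x)) = Complex.exp (Complex.I * κ * t) * Literature.Topology.FourManifolds.LefschetzBase.w g x) → (∀ t x, ‖Literature.Topology.FourManifolds.LefschetzBase.cx (θ (t, x))‖ ^ 2 < 4 ↔ ‖Literature.Topology.FourManifolds.LefschetzBase.cx x‖ ^ 2 < 4) → ∀ (η φ₀ : ℝ), 0 < φ₀ → φ₀ ≤ η → η * l.length < Real.pi → ∀ (P : Metric.sphere (0 : EuclideanSpace ℝ (Fin 2)) 1 → Literature.Topology.FourManifolds.LefschetzBase.Base g) (ν : Metric.sphere (0 : EuclideanSpace ℝ (Fin 2)) 1 → EuclideanSpace ℝ (Fin 4)), Literature.Geometry.Symplectic.IsBoundaryKnot P → Literature.Geometry.Symplectic.IsKnotFraming P ν → (∀ u, P u ∈ Literature.Topology.FourManifolds.LefschetzBase.page g (Literature.Topology.FourManifolds.LefschetzBase.pageDir l.length j * Complex.exp (-(φ₀ : ℂ) * Complex.I))) → ∃ (Ψ : Literature.Geometry.Symplectic.KnotIsotopyInBoundary P (fun u => R.toFun ((φ₀ - η) / κ) (P u))) (νt : ℝ → Metric.sphere (0 : EuclideanSpace ℝ (Fin 2))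 1 → EuclideanSpace ℝ (Fin 4)), (∀ t u, Ψ.toFun t u = R.toFun (Real.smoothTransition t * ((φ₀ - η) / κ)) (P u)) ∧ (∀ t u, νt t u = mfderiv (𝓡∂ 4) (𝓡∂ 4) (R.toFun (Real.smoothTransition t * ((φ₀ - η) / κ))) (P u) (ν u)) ∧ (∀ t u, Ψ.toFun t u ∈ Literature.Topology.FourManifolds.HandleAttachingMap.coresComplement h) ∧ (∀ t u, ∃ φ : ℝ, φ₀ ≤ φ ∧ φ ≤ η ∧ Ψ.toFun t u ∈ Literature.Topology.FourManifolds.LefschetzBase.page g (Literature.Topology.FourManifolds.LefschetzBase.pageDir l.length j * Complex.exp (-(φ : ℂ) * Complex.I))) ∧ Literature.Geometry.Symplectic.IsFramingAlong Ψ ν νt ∧ (∀ u, R.toFun ((φ₀ - η) / κ) (P u) ∈ Literature.Topology.FourManifolds.LefschetzBase.page g (Literature.Topology.FourManifolds.LefschetzBase.pageDir l.length j * Complex.exp (-(η : ℂ) * Complex.I))) ∧ (∀ (hc : Continuous P) (hc' : Continuous fun u => R.toFun ((φ₀ - η) / κ) (P u)), Literature.Topology.FourManifolds.LefschetzBase.shadow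 g (fun u => R.toFun ((φ₀ - η) / κ) (P u)) hc' = Literature.Topology.FourManifolds.LefschetzBase.shadow g P hc) ∧ Literature.Topology.FourManifolds.LefschetzBase.pageTwisting g (fun u => R.toFun ((φ₀ - η) / κ) (P u)) (νt 1) = Literature.Topology.FourManifolds.LefschetzBase.pageTwisting g P ν := by
  intro g l h hlink j R κ θ hκ hR1 hR2 hR3 η φ₀ hφ₀ hφη hηn P ν hP hν hPpage
  exact exists_pushoffRotation hlink j R hκ hR1 hR2 hR3 hφ₀ hφη hηn hPpage hP hν

end Summit.SmoothPoincare4.SmoothPoincare4.Theorems.AcyclicBisectionExists.ModpBraidOrbits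

end
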